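import Mathlib.Analysis.SpecialFunctions.Pow.Real
import Mathlib.Algebra.Order.Chebyshev
import HarnessLib

/-!
# Venture YMGap — track (b), item B4: the two-dimensional shadow of Tomboulis's (5.23) is TRUE —
# the 2D-torus vortex ratio `R_A(α)` is strictly decreasing in `α`

HONEST FRAMING: venture file (cell `pub-ymgap`, PLAN §B4). A finite closed-form statement about the
exactly solvable two-dimensional model; it decides NOTHING about `d = 3, 4`, about Tomboulis's disputed
inequality (5.15) there, or about confinement.

On a two-dimensional periodic lattice with `A` plaquettes the character expansion integrates out exactly
(Migdal 1975; Tomboulis arXiv:0707.2179 after (2.34): the decimations "become exact in space-time dimension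
`d = 2`"): with the normalised plaquette function `f = 1 + Σ_{j≠0} d_j c_j χ_j`,
`Z_A({c_j}) = Σ_j c_j^A` (`c_0 = 1`) and, with one twisted plaquette, `Z⁻_A({c_j}) = Σ_j (-1)^{2j} c_j^A`
(PLAN §B4 / STEP-0 S0-B1; these identities are the census engine's blind test and are NOT proved here).
Along Tomboulis's interpolation ray `c̃_j(α) = α c_j` (arXiv:0707.2179 (3.13) with `c^L = 0`; Ito–Seiler
arXiv:0711.4930 (2.6)) the 2D vortex free-energy ratio is therefore the closed form
`R_A(α) = (1 + Σ_{j≠0} (-1)^{2j} (α c_j)^A) / (1 + Σ_{j≠0} (α c_j)^A) = twoDimRatio A J c α`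
(spins indexed by `n = 2j`, cut-off `n ≤ J`; the printed object is `J = ∞`, where the same two-line
argument applies to the convergent sums).

THEOREM (`twoDimRatio_strictAntiOn`): for every `A ≥ 1`, every cut-off `J ≥ 1` and every coefficient
vector with `c_n ≥ 0` and `c_1 > 0` (the fundamental coefficient; for the Wilson action
`c_{1/2}(β) = I_2(β)/I_1(β) > 0` for `β > 0`), `α ↦ R_A(α)` is STRICTLY DECREASING on `[0, ∞)`, in
particular on Tomboulis's interval `(0, 1]`. Proof: with `x = α^A`, `T = Σ c_n^A ≥ 0` and
`T⁻ = Σ (-1)^n c_n^A < T`, `R = (1 + T⁻x)/(1 + Tx)` and `R(x) - R(y) = (T - T⁻)(y - x)/((1+Tx)(1+Ty))`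
(`ratio_strictAntiOn`). So the `d = 2` instance of Tomboulis's monotonicity (5.23) — "`d/dα (Z⁻/Z) < 0`"
— holds for all volumes and couplings, as it must where the decimation is exact; the content of the
Ito–Seiler dispute is entirely in `d ≥ 3`.

References: E. T. Tomboulis, arXiv:0707.2179, eqs. (2.34), (3.11), (3.13), (5.23); K. R. Ito, E. Seiler,
arXiv:0711.4930, eq. (2.6); A. A. Migdal, JETP 42 (1975) 413 (2D exact recursion).
-/

noncomputable section

open Finset Real
open scoped BigOperators

namespace Summit.Ventures.YMGap

/-- The closed-form ratio `x ↦ (1 + T⁻ x)/(1 + T x)`. -/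
def ratio (T Tm x : ℝ) : ℝ := (1 + Tm * x) / (1 + T * x)

/-- **The elementary monotonicity**: for `0 ≤ T` and `T⁻ < T` the map `x ↦ (1 + T⁻x)/(1 + Tx)` is strictly
decreasing on `[0, ∞)`: `R(x) - R(y) = (T - T⁻)(y - x)/((1 + Tx)(1 + Ty))`. -/
theorem ratio_strictAntiOn {T Tm : ℝ} (hT : 0 ≤ T) (hTm : Tm < T) :
    StrictAntiOn (ratio T Tm) (Set.Ici 0) := by
  intro x hx y hy hxy
  simp only [Set.mem_Ici] at hx hy
  have hx1 : 0 < 1 + T * x := by positivity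
  have hy1 : 0 < 1 + T * y := by positivity
  unfold ratio
  rw [div_lt_div_iff₀ hy1 hx1]
  nlinarith [mul_pos (sub_pos.2 hTm) (sub_pos.2 hxy)]

/-- **The 2D-torus vortex ratio along the interpolation ray** (closed form of
`Z⁻_A({α c_j})/Z_A({α c_j})` on a two-dimensional periodic lattice with `A` plaquettes and one twisted
plaquette; spins `n = 2j`, cut-off `n ≤ J`):
`R_A(α) = (1 + Σ_{n=1}^{J} (-1)^n (α c_n)^A)/(1 + Σ_{n=1}^{J} (α c_n)^A)`. -/
def twoDimRatio (A J : ℕ) (c : ℕ → ℝ) (α : ℝ) : ℝ :=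
  (1 + ∑ n ∈ Icc 1 J, (-1 : ℝ) ^ n * (α * c n) ^ A) / (1 + ∑ n ∈ Icc 1 J, (α * c n) ^ A)

/-- The untwisted character sum `T = Σ_{n=1}^{J} c_n^A`. -/
def charSum (A J : ℕ) (c : ℕ → ℝ) : ℝ := ∑ n ∈ Icc 1 J, c n ^ A

/-- The twisted character sum `T⁻ = Σ_{n=1}^{J} (-1)^n c_n^A`. -/
def charSumTwist (A J : ℕ) (c : ℕ → ℝ) : ℝ := ∑ n ∈ Icc 1 J, (-1 : ℝ) ^ n * c n ^ A

/-- `R_A(α) = ratio T T⁻ (α^A)`: the coupling enters only through `x = α^A`. -/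
theorem twoDimRatio_eq_ratio (A J : ℕ) (c : ℕ → ℝ) (α : ℝ) :
    twoDimRatio A J c α = ratio (charSum A J c) (charSumTwist A J c) (α ^ A) := by
  unfold twoDimRatio ratio charSum charSumTwist
  congr 1
  · rw [Finset.sum_mul]
    congr 1
    refine Finset.sum_congr rfl fun n _ => ?_
    rw [mul_pow]; ring
  · rw [Finset.sum_mul]
    congr 1
    refine Finset.sum_congr rfl fun n _ => ?_
    rw [mul_pow]; ring

/-- `T ≥ 0` for non-negative coefficients. -/
theorem charSum_nonneg {A J : ℕ} {c : ℕ → ℝ} (hc : ∀ n, 0 ≤ c n) : 0 ≤ charSum A J c :=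
  Finset.sum_nonneg fun n _ => pow_nonneg (hc n) A

/-- `T⁻ < T` as soon as the fundamental coefficient `c_1 = c_{1/2}` is positive (and `J ≥ 1`): the
difference is `Σ_n (1 - (-1)^n) c_n^A ≥ 2 c_1^A > 0`. -/
theorem charSumTwist_lt_charSum {A J : ℕ} {c : ℕ → ℝ} (hc : ∀ n, 0 ≤ c n) (h1 : 0 < c 1)
    (hJ : 1 ≤ J) : charSumTwist A J c < charSum A J c := by
  unfold charSum charSumTwist
  rw [← sub_pos, ← Finset.sum_sub_distrib]
  have hterm : ∀ n ∈ Icc 1 J, 0 ≤ c n ^ A - (-1 : ℝ) ^ n * c n ^ A := fun n _ => by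
    have hcn : 0 ≤ c n ^ A := pow_nonneg (hc n) A
    rcases neg_one_pow_eq_or ℝ n with h | h <;> rw [h] <;> nlinarith
  have h1mem : 1 ∈ Icc 1 J := Finset.mem_Icc.2 ⟨le_rfl, hJ⟩
  refine lt_of_lt_of_le ?_ (Finset.single_le_sum hterm h1mem)
  have : (0 : ℝ) < c 1 ^ A := pow_pos h1 A
  simp only [pow_one]
  linarith

/-- **B4 — the two-dimensional vortex ratio is strictly decreasing in `α`.** For every `A ≥ 1`, cut-off
`J ≥ 1` and coefficients `c_n ≥ 0` with `c_1 > 0`, `α ↦ R_A(α)` is strictly antitone on `[0, ∞)`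
(hence on Tomboulis's `(0, 1]`): the `d = 2` instance of arXiv:0707.2179 (5.23) holds at every volume and
coupling. -/
theorem twoDimRatio_strictAntiOn {A J : ℕ} (hA : 1 ≤ A) (hJ : 1 ≤ J) {c : ℕ → ℝ} (hc : ∀ n, 0 ≤ c n)
    (h1 : 0 < c 1) : StrictAntiOn (twoDimRatio A J c) (Set.Ici 0) := by
  intro x hx y hy hxy
  simp only [Set.mem_Ici] at hx hy
  rw [twoDimRatio_eq_ratio, twoDimRatio_eq_ratio]
  have hA0 : A ≠ 0 := by omega
  exact ratio_strictAntiOn (charSum_nonneg hc) (charSumTwist_lt_charSum hc h1 hJ)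
    (Set.mem_Ici.2 (pow_nonneg hx A)) (Set.mem_Ici.2 (pow_nonneg hy A))
    (pow_lt_pow_left₀ hxy hx hA0)

/-- In particular `R_A` is antitone on `[0, 1]` (the weak form matching `AntitoneOn` statements such as
`Literature…Tomboulis2007.VortexRatioAntitone`). -/
theorem twoDimRatio_antitoneOn {A J : ℕ} (hA : 1 ≤ A) (hJ : 1 ≤ J) {c : ℕ → ℝ} (hc : ∀ n, 0 ≤ c n)
    (h1 : 0 < c 1) : AntitoneOn (twoDimRatio A J c) (Set.Icc 0 1) :=
  ((twoDimRatio_strictAntiOn hA hJ hc h1).antitoneOn).mono fun _ hx => Set.mem_Ici.2 hx.1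

/-- And `R_A(α) ≤ R_A(0) = 1`, `R_A(1) ≤ R_A(α)` on `[0,1]`: the twisted 2D partition function never
exceeds the untwisted one along the ray (the `d = 2` instance of Tomboulis's IV.1) and is bounded below
by its `α = 1` value (the `d = 2` instance of (5.22) with exact decimation). -/
theorem twoDimRatio_le_one {A J : ℕ} (hA : 1 ≤ A) (hJ : 1 ≤ J) {c : ℕ → ℝ} (hc : ∀ n, 0 ≤ c n)
    (h1 : 0 < c 1) {α : ℝ} (hα : α ∈ Set.Icc (0 : ℝ) 1) :
    twoDimRatio A J c 1 ≤ twoDimRatio A J c α ∧ twoDimRatio A J c α ≤ 1 := by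
  have hanti := twoDimRatio_antitoneOn hA hJ hc h1
  have h0 : (0 : ℝ) ∈ Set.Icc (0 : ℝ) 1 := ⟨le_rfl, zero_le_one⟩
  have h1' : (1 : ℝ) ∈ Set.Icc (0 : ℝ) 1 := ⟨zero_le_one, le_rfl⟩
  refine ⟨hanti hα h1' hα.2, ?_⟩
  have hR0 : twoDimRatio A J c 0 = 1 := by
    have hA0 : A ≠ 0 := by omega
    simp [twoDimRatio, zero_pow hA0]
  rw [← hR0]
  exact hanti h0 hα hα.1

end Summit.Ventures.YMGap
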